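import Summits.QuantumFields.YangMills.Theorems.BalabanUVNodesPortZDPencilDerivative
import Mathlib.MeasureTheory.Integral.IntervalIntegral.FundThmCalculus

/-!
# NODE O port, row PT-A′ helper lane (PTZ-1, gen 3): [II] (1.9) «WE APPLY THE FUNDAMENTAL THEOREM OF CALCULUS» IN THE HISTORY MULTIPLIER — the history response
# `R_k(A + E)(W) − R_k(A)(W) + E(bg_1)` IS THE INTEGRAL OVER `t ∈ [0,1]` OF THE FIRST-ORDER TERMS OF THE INTERPOLATING `(A + t·E)`-STEPS (the tilted fibre means of print's curly
# bracket at `W` minus at `1`) — generic over `Node00/ZeroInputStepT`; fibre laws of the `A`-step DISPLAYED through `hμ`, brackets a.e.-bounded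

[Balaban1987RG1] = [I] (CMP 109, 1987): (1.6) p. 261, (2.12)–(2.14) p. 268; [Balaban1988RG2Cluster] = [II] (CMP 116, 1988): (1.9) p. 4 («Now, as in cluster expansions, we apply the fundamental
theorem of calculus»), p. 21.

Seat `ymgap-nodeO-port-PTZ-1` g3 (prover, HELPER MODE; `--supports stmt-QuantumFields-27930 --as helper`).  Generic layer (0 tokens of the χ-cone of record); CRIT-1 Q-5 (β).  Companion of
`…PortZDPencilDerivative` (✓p808703: `hasDerivAt_integral_exp_mul_of_ae_bound`, `integrable_exp_mul_of_ae_bound`), `…PortZDStepLaw` (✓p807160), `…PortZDHistoryFluctuation` (✓p805483).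
WHAT IS PROVED (0 sorry; no `def` ∕ `instance` ∕ `notation`):
* §1 generic (probability space, `|F| ≤ M` a.e.): `continuous_integral_exp_mul_of_ae_bound`, `continuous_integral_mul_exp_mul_of_ae_bound` (dominated continuity),
  ★ `hasDerivAt_log_integral_exp_mul_of_ae_bound` (`t ↦ log ∫ e^{tF} dμ` has derivative the TILTED MEAN `∫ F e^{tF} ∕ ∫ e^{tF}` at every `t`), `continuous_tiltedMean_of_ae_bound`,
  ★★ `log_integral_exp_eq_integral_tiltedMean` — FTC: `log ∫ e^{F} dμ = ∫₀¹ (∫ F e^{tF} dμ ∕ ∫ e^{tF} dμ) dt`.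
* §2 ★ `tiltedMean_eq_firstOrder_of_stepLaw` — under the fibre law of the `A`-step: the tilted mean at `t` IS the first-order term `T(F·I(A + t·F))(V) ∕ T(I(A + t·F))(V)` of the
  INTERPOLATING step; ★★ `log_moment_eq_integral_firstOrder_of_stepLaw` — `log[T(I(A + F))(V) ∕ T(I(A))(V)] = ∫₀¹ T(F·I(A + tF))(V) ∕ T(I(A + tF))(V) dt`.
* §3 ★★ `stepOutT_add_sub_eq_integral_firstOrder` — `R_k(A + E)(W) − R_k(A)(W) + E(bg_1) = ∫₀¹ [ T(F_W·I(A + tF_W))(W) ∕ T(I(A + tF_W))(W) − T(F_1·I(A + tF_1))(1) ∕ T(I(A + tF_1))(1) ] dt`,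
  `F_V := E − E(bg_V)`; ★★ `dChannel_eq_integral_firstOrder` — the instance `(A⁰_k, 𝐄_k)` with `GaugeInvariant A_k`: 𝓓_{k+1}(W) as the `t`-integral of the interpolating first-order terms.
HONEST FRAMING.  Calculus bookkeeping; fibre laws, positivity, bounds, `GaugeInvariant A_k` DISPLAYED; NOTHING of Bałaban's estimates asserted, ported or discharged; no named fact introduced;
26648 ∕ 27930⁸ SIGNED·OPEN (content-gated), 27931 OPEN (RC-3), 27932 CLOSED; K0⁷ ∕ K-Ax OPEN; counts unmoved; finite 𝕋⁴ at fixed ε — NOT continuum ∕ OS ∕ Clay; the Yang–Mills mass gap is NOT proved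
by any of this.  No `sorry`, no `instance`, no `notation`, no `def`.
-/

noncomputable section

open MeasureTheory intervalIntegral

namespace Summit.QuantumFields.YangMills.Theorems.PortZD

open Literature.MathematicalPhysics.QuantumFieldTheory.Balaban1983to89
open Literature.MathematicalPhysics.QuantumFieldTheory.Balaban1983to89.Node00
open Literature.MathematicalPhysics.QuantumFieldTheory.Balaban1983to89.Node00.ZeroInput
open T4Continuum (T4Family)
open B12Eq019ActionBody (nextAction normConst integrand integrand_apply)
open GaugeField (GaugeInvariant)

/-! ## §1. The cumulant generating function: continuity, derivative = tilted mean, FTC -/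

section Generic

variable {X : Type*} [MeasurableSpace X] {μ : Measure X} [IsProbabilityMeasure μ] {F : X → ℝ} {M : ℝ}

/-- `t ↦ ∫ e^{tF} dμ` is continuous (it is differentiable everywhere). [cite: Balaban1988RG2Cluster, (1.9) p.4 (bookkeeping)] -/
theorem continuous_integral_exp_mul_of_ae_bound (hFm : AEStronglyMeasurable F μ) (hb : ∀ᵐ x ∂μ, |F x| ≤ M) :
    Continuous fun s : ℝ => ∫ x, Real.exp (s * F x) ∂μ :=
  continuous_iff_continuousAt.2 fun t => (hasDerivAt_integral_exp_mul_of_ae_bound hFm hb t).continuousAt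

/-- `t ↦ ∫ F·e^{tF} dμ` is continuous (dominated continuity on the ball of radius `1`). [cite: Balaban1988RG2Cluster, (1.9) p.4 (bookkeeping)] -/
theorem continuous_integral_mul_exp_mul_of_ae_bound (hFm : AEStronglyMeasurable F μ) (hb : ∀ᵐ x ∂μ, |F x| ≤ M) :
    Continuous fun s : ℝ => ∫ x, F x * Real.exp (s * F x) ∂μ := by
  have hM : 0 ≤ M := by
    obtain ⟨x, hx⟩ := hb.exists
    exact (abs_nonneg _).trans hx
  refine continuous_iff_continuousAt.2 fun t => ?_
  refine continuousAt_of_dominated (bound := fun _ => M * Real.exp ((|t| + 1) * M)) ?_ ?_ (integrable_const _) ?_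
  · exact Filter.Eventually.of_forall fun s => hFm.mul (Real.continuous_exp.comp_aestronglyMeasurable (hFm.const_mul s))
  · have hball : Metric.ball t 1 ∈ nhds t := Metric.ball_mem_nhds t one_pos
    filter_upwards [hball] with s hs
    filter_upwards [hb] with x hx
    rw [Metric.mem_ball, Real.dist_eq] at hs
    rw [Real.norm_eq_abs, abs_mul, abs_of_pos (Real.exp_pos _)]
    refine mul_le_mul hx (Real.exp_le_exp.2 ?_) (Real.exp_pos _).le hM
    have hs' : |s| ≤ |t| + 1 := by
      have h1 := abs_sub_abs_le_abs_sub s t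
      linarith
    calc s * F x ≤ |s * F x| := le_abs_self _
      _ = |s| * |F x| := abs_mul _ _
      _ ≤ (|t| + 1) * M := mul_le_mul hs' hx (abs_nonneg _) (by positivity)
  · exact Filter.Eventually.of_forall fun x => (continuous_const.mul (Real.continuous_exp.comp (continuous_id.mul continuous_const))).continuousAt

/-- ★ **THE DERIVATIVE OF THE CUMULANT GENERATING FUNCTION IS THE TILTED MEAN**, at every `t`. [cite: Balaban1988RG2Cluster, (1.9) p.4 (bookkeeping)] -/
theorem hasDerivAt_log_integral_exp_mul_of_ae_bound (hFm : AEStronglyMeasurable F μ) (hb : ∀ᵐ x ∂μ, |F x| ≤ M) (t : ℝ) :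
    HasDerivAt (fun s => Real.log (∫ x, Real.exp (s * F x) ∂μ))
      ((∫ x, F x * Real.exp (t * F x) ∂μ) / ∫ x, Real.exp (t * F x) ∂μ) t :=
  (hasDerivAt_integral_exp_mul_of_ae_bound hFm hb t).log (integral_exp_pos (integrable_exp_mul_of_ae_bound hFm hb t)).ne'

/-- The tilted mean is continuous in `t`. [cite: Balaban1988RG2Cluster, (1.9) p.4 (bookkeeping)] -/
theorem continuous_tiltedMean_of_ae_bound (hFm : AEStronglyMeasurable F μ) (hb : ∀ᵐ x ∂μ, |F x| ≤ M) :
    Continuous fun s : ℝ => (∫ x, F x * Real.exp (s * F x) ∂μ) / ∫ x, Real.exp (s * F x) ∂μ :=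
  (continuous_integral_mul_exp_mul_of_ae_bound hFm hb).div (continuous_integral_exp_mul_of_ae_bound hFm hb)
    fun s => (integral_exp_pos (integrable_exp_mul_of_ae_bound hFm hb s)).ne'

/-- ★★ **FTC IN THE MULTIPLIER**: `log ∫ e^{F} dμ = ∫₀¹ (∫ F e^{tF} dμ ∕ ∫ e^{tF} dμ) dt`. [cite: Balaban1988RG2Cluster, (1.9) p.4, p.21 (mechanism; bookkeeping)] -/
theorem log_integral_exp_eq_integral_tiltedMean (hFm : AEStronglyMeasurable F μ) (hb : ∀ᵐ x ∂μ, |F x| ≤ M) :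
    Real.log (∫ x, Real.exp (F x) ∂μ) = ∫ t in (0 : ℝ)..1, (∫ x, F x * Real.exp (t * F x) ∂μ) / ∫ x, Real.exp (t * F x) ∂μ := by
  have h := integral_eq_sub_of_hasDerivAt (a := (0 : ℝ)) (b := 1) (fun t _ => hasDerivAt_log_integral_exp_mul_of_ae_bound hFm hb t)
    ((continuous_tiltedMean_of_ae_bound hFm hb).intervalIntegrable 0 1)
  rw [h]
  simp

end Generic

/-! ## §2. The tilted mean is the first-order term of the interpolating step -/

section StepLaw

variable {P : Params} {G : Type*} {k : ℕ} [MeasurableSpace (GaugeField P k G)]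

/-- ★ Under the fibre law of the `A`-step at `V`: the tilted mean at `t` IS the first-order term of the INTERPOLATING `(A + t·F)`-step,
`(∫ F e^{tF} dμ) ∕ (∫ e^{tF} dμ) = T(F·I(A + t·F))(V) ∕ T(I(A + t·F))(V)` (`T(I(A))(V) ≠ 0`). [cite: Balaban1987RG1, (2.12)–(2.13) p.268 (bookkeeping)] -/
theorem tiltedMean_eq_firstOrder_of_stepLaw {T : Density P k G → Density P (k + 1) G} {χ GF : Density P k G} {gk : ℝ} {A : Density P k G}
    {V : GaugeField P (k + 1) G} {μ : Measure (GaugeField P k G)}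
    (hμ : ∀ f : Density P k G, ∫ U, f U ∂μ = T (fun U => f U * integrand χ GF gk A U) V / T (integrand χ GF gk A) V)
    (hZ : T (integrand χ GF gk A) V ≠ 0) (F : Density P k G) (t : ℝ) :
    (∫ U, F U * Real.exp (t * F U) ∂μ) / ∫ U, Real.exp (t * F U) ∂μ =
      T (fun U => F U * integrand χ GF gk (A + t • F) U) V / T (integrand χ GF gk (A + t • F)) V := by
  have h1 : ∫ U, Real.exp (t * F U) ∂μ = T (integrand χ GF gk (A + t • F)) V / T (integrand χ GF gk A) V := by
    rw [moment_eq_integral_exp_of_stepLaw hμ (t • F)]; simp only [Pi.smul_apply, smul_eq_mul]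
  have h2 : ∫ U, F U * Real.exp (t * F U) ∂μ = T (fun U => F U * integrand χ GF gk (A + t • F) U) V / T (integrand χ GF gk A) V := by
    rw [hμ]
    congr 2
    funext U
    rw [integrand_apply, integrand_apply, Pi.add_apply, Pi.smul_apply, smul_eq_mul, ← add_assoc, Real.exp_add (-(1 / gk ^ 2) * GF U + A U) (t * F U)]
    ring
  rw [h1, h2, div_div_div_cancel_right₀ hZ]

/-- ★★ **THE LOG-MOMENT IS THE INTEGRAL OF THE INTERPOLATING FIRST-ORDER TERMS**: `log[T(I(A + F))(V) ∕ T(I(A))(V)] = ∫₀¹ T(F·I(A + tF))(V) ∕ T(I(A + tF))(V) dt` (fibre law of the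
`A`-step displayed; `|F| ≤ M` a.e.). [cite: Balaban1988RG2Cluster, (1.9) p.4, p.21; Balaban1987RG1, (2.12)–(2.14) p.268] -/
theorem log_moment_eq_integral_firstOrder_of_stepLaw {T : Density P k G → Density P (k + 1) G} {χ GF : Density P k G} {gk : ℝ} {A : Density P k G}
    {V : GaugeField P (k + 1) G} {μ : Measure (GaugeField P k G)}
    (hμ : ∀ f : Density P k G, ∫ U, f U ∂μ = T (fun U => f U * integrand χ GF gk A U) V / T (integrand χ GF gk A) V)
    (hZ : T (integrand χ GF gk A) V ≠ 0) (F : Density P k G) {M : ℝ} (hFm : AEStronglyMeasurable F μ) (hb : ∀ᵐ U ∂μ, |F U| ≤ M) :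
    Real.log (T (integrand χ GF gk (A + F)) V / T (integrand χ GF gk A) V) =
      ∫ t in (0 : ℝ)..1, T (fun U => F U * integrand χ GF gk (A + t • F) U) V / T (integrand χ GF gk (A + t • F)) V := by
  haveI := isProbabilityMeasure_of_stepLaw hμ hZ
  rw [moment_eq_integral_exp_of_stepLaw hμ F, log_integral_exp_eq_integral_tiltedMean hFm hb]
  refine intervalIntegral.integral_congr fun t _ => ?_
  exact tiltedMean_eq_firstOrder_of_stepLaw hμ hZ F t

/-- The interpolating first-order term is continuous in `t` (it is the tilted mean). [cite: Balaban1988RG2Cluster, (1.9) p.4 (bookkeeping)] -/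
theorem continuous_firstOrder_of_stepLaw {T : Density P k G → Density P (k + 1) G} {χ GF : Density P k G} {gk : ℝ} {A : Density P k G}
    {V : GaugeField P (k + 1) G} {μ : Measure (GaugeField P k G)}
    (hμ : ∀ f : Density P k G, ∫ U, f U ∂μ = T (fun U => f U * integrand χ GF gk A U) V / T (integrand χ GF gk A) V)
    (hZ : T (integrand χ GF gk A) V ≠ 0) (F : Density P k G) {M : ℝ} (hFm : AEStronglyMeasurable F μ) (hb : ∀ᵐ U ∂μ, |F U| ≤ M) :
    Continuous fun t : ℝ => T (fun U => F U * integrand χ GF gk (A + t • F) U) V / T (integrand χ GF gk (A + t • F)) V := by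
  haveI := isProbabilityMeasure_of_stepLaw hμ hZ
  have h := continuous_tiltedMean_of_ae_bound hFm hb
  refine h.congr fun t => ?_
  exact tiltedMean_eq_firstOrder_of_stepLaw hμ hZ F t

end StepLaw

/-! ## §3. The history response and the channel as integrals of interpolating first-order terms -/

variable (F : T4Family) (N : ℕ) [NeZero N]

/-- ★★ **[II] (1.9) FOR THE HISTORY RESPONSE**: `T K k` degree-one homogeneous; fibre laws `μW`, `μ1` of the `A`-step at `W`, `1`; the `A`-step defined there; the brackets `F_V := E − E(bg_V)`
a.e.-bounded.  Then `R_k(A + E)(W) − R_k(A)(W) + E(bg_1) = ∫₀¹ [ T(F_W·I(A + tF_W))(W) ∕ T(I(A + tF_W))(W) − T(F_1·I(A + tF_1))(1) ∕ T(I(A + tF_1))(1) ] dt`.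
[cite: Balaban1988RG2Cluster, (1.9) p.4, p.21; Balaban1987RG1, (1.6) p.261, (2.12)–(2.14) p.268] -/
theorem stepOutT_add_sub_eq_integral_firstOrder (T : Transport F N) (χ : (K : ℕ) → (ℕ → ℝ) → (k : ℕ) → Density (F.P K) k (SU N)) (ε : ℝ) (K : ℕ)
    (g : ℕ → ℝ) (k : ℕ) (hT : ∀ (a : ℝ) (ρ : Density (F.P K) k (SU N)), T K k (fun U => a * ρ U) = fun V => a * T K k ρ V)
    (A E : Density (F.P K) k (SU N)) (W : GaugeField (F.P K) (k + 1) (SU N)) {μW μ1 : Measure (GaugeField (F.P K) k (SU N))}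
    (hμW : ∀ f : Density (F.P K) k (SU N),
      ∫ U, f U ∂μW = T K k (fun U => f U * integrand (χ K g k) (gfOfRecord F N K k) (g k) A U) W / T K k (integrand (χ K g k) (gfOfRecord F N K k) (g k) A) W)
    (hμ1 : ∀ f : Density (F.P K) k (SU N),
      ∫ U, f U ∂μ1 = T K k (fun U => f U * integrand (χ K g k) (gfOfRecord F N K k) (g k) A U) 1 / T K k (integrand (χ K g k) (gfOfRecord F N K k) (g k) A) 1)
    (hAW : 0 < T K k (integrand (χ K g k) (gfOfRecord F N K k) (g k) A) W)
    (hA1 : 0 < T K k (integrand (χ K g k) (gfOfRecord F N K k) (g k) A) 1) {MW M1 : ℝ}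
    (hmW : AEStronglyMeasurable (fun U => E U - E (Averaging.iter (avOfRecord F N K) k (Uk F N K (k + 1) ε W))) μW)
    (hm1 : AEStronglyMeasurable (fun U => E U - E (Averaging.iter (avOfRecord F N K) k (Uk F N K (k + 1) ε 1))) μ1)
    (hbW : ∀ᵐ U ∂μW, |E U - E (Averaging.iter (avOfRecord F N K) k (Uk F N K (k + 1) ε W))| ≤ MW)
    (hb1 : ∀ᵐ U ∂μ1, |E U - E (Averaging.iter (avOfRecord F N K) k (Uk F N K (k + 1) ε 1))| ≤ M1) :
    stepOutT F N T χ ε K g k (A + E) W - stepOutT F N T χ ε K g k A W + E (Averaging.iter (avOfRecord F N K) k (Uk F N K (k + 1) ε 1)) =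
      ∫ t in (0 : ℝ)..1,
        (T K k (fun U => (E U - E (Averaging.iter (avOfRecord F N K) k (Uk F N K (k + 1) ε W))) *
              integrand (χ K g k) (gfOfRecord F N K k) (g k) (A + t • fun U => E U - E (Averaging.iter (avOfRecord F N K) k (Uk F N K (k + 1) ε W))) U) W /
            T K k (integrand (χ K g k) (gfOfRecord F N K k) (g k) (A + t • fun U => E U - E (Averaging.iter (avOfRecord F N K) k (Uk F N K (k + 1) ε W)))) W -
          T K k (fun U => (E U - E (Averaging.iter (avOfRecord F N K) k (Uk F N K (k + 1) ε 1))) *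
              integrand (χ K g k) (gfOfRecord F N K k) (g k) (A + t • fun U => E U - E (Averaging.iter (avOfRecord F N K) k (Uk F N K (k + 1) ε 1))) U) 1 /
            T K k (integrand (χ K g k) (gfOfRecord F N K k) (g k) (A + t • fun U => E U - E (Averaging.iter (avOfRecord F N K) k (Uk F N K (k + 1) ε 1)))) 1) := by
  set cW := E (Averaging.iter (avOfRecord F N K) k (Uk F N K (k + 1) ε W)) with hcW
  set c1 := E (Averaging.iter (avOfRecord F N K) k (Uk F N K (k + 1) ε 1)) with hc1
  haveI := isProbabilityMeasure_of_stepLaw hμW hAW.ne'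
  haveI := isProbabilityMeasure_of_stepLaw hμ1 hA1.ne'
  have hXW : 0 < T K k (integrand (χ K g k) (gfOfRecord F N K k) (g k) (A + fun U => E U - cW)) W :=
    transport_integrand_add_pos_of_stepLaw hμW hAW _ (by simpa using integrable_exp_mul_of_ae_bound hmW hbW 1)
  have hX1 : 0 < T K k (integrand (χ K g k) (gfOfRecord F N K k) (g k) (A + fun U => E U - c1)) 1 :=
    transport_integrand_add_pos_of_stepLaw hμ1 hA1 _ (by simpa using integrable_exp_mul_of_ae_bound hm1 hb1 1)
  have hEW : 0 < T K k (integrand (χ K g k) (gfOfRecord F N K k) (g k) (A + E)) W := by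
    rw [transport_integrand_add_recentre hT _ _ _ A E cW W]; exact mul_pos (Real.exp_pos _) hXW
  have hE1 : 0 < T K k (integrand (χ K g k) (gfOfRecord F N K k) (g k) (A + E)) 1 := by
    rw [transport_integrand_add_recentre hT _ _ _ A E c1 1]; exact mul_pos (Real.exp_pos _) hX1
  rw [stepOutT_add_sub_eq_log_fluct F N T χ ε K g k hT A E W hAW hA1 hEW hE1, sub_add_cancel,
    log_moment_eq_integral_firstOrder_of_stepLaw hμW hAW.ne' (fun U => E U - cW) hmW hbW,
    log_moment_eq_integral_firstOrder_of_stepLaw hμ1 hA1.ne' (fun U => E U - c1) hm1 hb1,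
    ← intervalIntegral.integral_sub ((continuous_firstOrder_of_stepLaw hμW hAW.ne' (fun U => E U - cW) hmW hbW).intervalIntegrable 0 1)
      ((continuous_firstOrder_of_stepLaw hμ1 hA1.ne' (fun U => E U - c1) hm1 hb1).intervalIntegrable 0 1)]

/-- ★★ **[II] (1.9) FOR THE HISTORY CHANNEL**: with `A := A⁰_k`, `E := 𝐄_k`, `GaugeInvariant A_k` (unit normalisation; `ε > 0`, `k + 1 ≤ m + K`), fibre laws of the ZERO-INPUT step at `W`, `1`
displayed, brackets a.e.-bounded: `𝓓_{k+1}(W) = ∫₀¹ [first-order term of the (A⁰_k + t·(𝐄_k − 𝐄_k(bg_W)))-step at W − that of the (A⁰_k + t·𝐄_k)-step at 1] dt`.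
[cite: Balaban1988RG2Cluster, (1.9) p.4, p.21; Balaban1987RG1, (1.6) p.261, (2.12)–(2.14) p.268, (2.16) p.269] -/
theorem dChannel_eq_integral_firstOrder (T : Transport F N) (χ : (K : ℕ) → (ℕ → ℝ) → (k : ℕ) → Density (F.P K) k (SU N)) {ε : ℝ} (hε : 0 < ε)
    {K : ℕ} (g : ℕ → ℝ) {k : ℕ} (hk : k + 1 ≤ (F.P K).m + (F.P K).K)
    (hT : ∀ (a : ℝ) (ρ : Density (F.P K) k (SU N)), T K k (fun U => a * ρ U) = fun V => a * T K k ρ V)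
    (hinv : GaugeInvariant (effActionHT F N T χ K g k)) (W : GaugeField (F.P K) (k + 1) (SU N)) {μW μ1 : Measure (GaugeField (F.P K) k (SU N))}
    (hμW : ∀ f : Density (F.P K) k (SU N),
      ∫ U, f U ∂μW = T K k (fun U => f U * integrand (χ K g k) (gfOfRecord F N K k) (g k) (mainTermT F N ε K g k) U) W /
        T K k (integrand (χ K g k) (gfOfRecord F N K k) (g k) (mainTermT F N ε K g k)) W)
    (hμ1 : ∀ f : Density (F.P K) k (SU N),
      ∫ U, f U ∂μ1 = T K k (fun U => f U * integrand (χ K g k) (gfOfRecord F N K k) (g k) (mainTermT F N ε K g k) U) 1 /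
        T K k (integrand (χ K g k) (gfOfRecord F N K k) (g k) (mainTermT F N ε K g k)) 1)
    (h0W : 0 < T K k (integrand (χ K g k) (gfOfRecord F N K k) (g k) (mainTermT F N ε K g k)) W)
    (h01 : 0 < T K k (integrand (χ K g k) (gfOfRecord F N K k) (g k) (mainTermT F N ε K g k)) 1) {MW M1 : ℝ}
    (hmW : AEStronglyMeasurable (fun U => EkT F N T χ ε K g k U - EkT F N T χ ε K g k (Averaging.iter (avOfRecord F N K) k (Uk F N K (k + 1) ε W))) μW)
    (hm1 : AEStronglyMeasurable (EkT F N T χ ε K g k) μ1)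
    (hbW : ∀ᵐ U ∂μW, |EkT F N T χ ε K g k U - EkT F N T χ ε K g k (Averaging.iter (avOfRecord F N K) k (Uk F N K (k + 1) ε W))| ≤ MW)
    (hb1 : ∀ᵐ U ∂μ1, |EkT F N T χ ε K g k U| ≤ M1) :
    mergedTermT F N T χ ε K g k W - zeroInputMergedTermT F N T χ ε K g k W =
      ∫ t in (0 : ℝ)..1,
        (T K k (fun U => (EkT F N T χ ε K g k U - EkT F N T χ ε K g k (Averaging.iter (avOfRecord F N K) k (Uk F N K (k + 1) ε W))) *
              integrand (χ K g k) (gfOfRecord F N K k) (g k)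
                (mainTermT F N ε K g k + t • fun U => EkT F N T χ ε K g k U - EkT F N T χ ε K g k (Averaging.iter (avOfRecord F N K) k (Uk F N K (k + 1) ε W))) U) W /
            T K k (integrand (χ K g k) (gfOfRecord F N K k) (g k)
                (mainTermT F N ε K g k + t • fun U => EkT F N T χ ε K g k U - EkT F N T χ ε K g k (Averaging.iter (avOfRecord F N K) k (Uk F N K (k + 1) ε W)))) W -
          T K k (fun U => EkT F N T χ ε K g k U * integrand (χ K g k) (gfOfRecord F N K k) (g k) (mainTermT F N ε K g k + t • EkT F N T χ ε K g k) U) 1 /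
            T K k (integrand (χ K g k) (gfOfRecord F N K k) (g k) (mainTermT F N ε K g k + t • EkT F N T χ ε K g k)) 1) := by
  have h0 := EkT_iter_Uk_one_of_gaugeInvariant F N T χ hε g hk hinv
  have hE0 : (fun U => EkT F N T χ ε K g k U - EkT F N T χ ε K g k (Averaging.iter (avOfRecord F N K) k (Uk F N K (k + 1) ε 1))) = EkT F N T χ ε K g k := by
    funext U; rw [h0, sub_zero]
  have h := stepOutT_add_sub_eq_integral_firstOrder F N T χ ε K g k hT (mainTermT F N ε K g k) (EkT F N T χ ε K g k) W hμW hμ1 h0W h01 hmW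
    (by rw [hE0]; exact hm1) hbW (by simpa only [h0, sub_zero] using hb1)
  rw [h0, add_zero, ← effActionHT_eq_main_add_Ek_fun, ← mergedTermT_eq_stepOut, ← zeroInputMergedTermT_eq_stepOut] at h
  rw [h]
  simp only [sub_zero]

end Summit.QuantumFields.YangMills.Theorems.PortZD

end
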